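import Summits.BirchSwinnertonDyer.BirchSwinnertonDyer.Theorems.PrintX9GoodModelKernelH1OfTrace
import Summits.BirchSwinnertonDyer.BirchSwinnertonDyer.Theorems.ThetaPartnerAtTwoSignedControlAtTwoCoatesGreenbergOfCyclotomicZp
import Literature.NumberTheory.GaloisRepresentations.UnramifiedQuotientTraceProofs
import Literature.NumberTheory.GaloisRepresentations.DecompositionGroupOfCompletion
import Literature.NumberTheory.EllipticCurves.AnticyclotomicInertiaAboveP
import Literature.NumberTheory.EllipticCurves.IwasawaCyclotomicProofs
import Literature.NumberTheory.EllipticCurves.CoatesGreenberg1996.CyclotomicZpExtensionDeeplyRamifiedProofs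
import Literature.NumberTheory.EllipticCurves.CoatesGreenberg1996.GoodModelKernelH1Trivial
import HarnessLib

/-!
# `H¹(K_{∞,w}⁻, E₁(K̄_v)) = 0` — the Coates–Greenberg vanishing for the ANTICYCLOTOMIC tower of an
# imaginary quadratic field above a split prime (cell `pub/bsd-print-x9`, CG-FRAME (C2), item 23237)

For `K` imaginary quadratic, `p` odd and SPLIT in `K` (`v ≠ v̄` above `p`), `κ` the anticyclotomic
`ℤ_p`-extension and `E = W/K` elliptic with good reduction at `v`: every continuous crossed
homomorphism of the local group `(ker κ)_v = Gal(K̄_v/K_{∞,w}⁻)` with values in the kernel of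
reduction `E₁(K̄_v)` is the coboundary of a point of `E₁(K̄_v)`
(`exists_mem_localKernelOfReduction_eq_smul_sub_of_isAnticyclotomic`) — the currency of the tree's
record (I2) `WeierstrassCurve.CoatesGreenberg1996_H1_formalGroup_trivial` (cyclotomic tower), now for
the anticyclotomic tower.  This is [CoGr] Prop. 4.3 / Cor. 3.2 for the deeply ramified field
`K_{∞,w}⁻` (Greenberg, LNM 1716 p. 84: "a ramified `ℤ_p`-extension … is the simplest example of a
deeply ramified extension"), proved WITHOUT Tate's lemma for that tower:

1. `G₁ = (ker κ)_v ∩ (ker κ^{cyc})_v` is closed and below `(ker κ^{cyc})_v`, so the CYCLOTOMIC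
   Coates–Greenberg theorem `H1_goodModelKernel_trivial_of_cyclotomicZpExtension deeplyRamified_cyclotomicZpExtension_trace_holds` (Tate's almost étale lemma for the
   cyclotomic tower, PAdicHodge) kills the restriction of the cocycle to `G₁`: subtract that
   coboundary; the difference `φ₁` vanishes on `G₁` and its values are `G₁`-fixed.
2. `K̃_∞/K_∞⁻` is UNRAMIFIED above the split `p` — the tree's class field theory
   `ZpExtension.inertia_inf_kerSubgroup_le_kerSubgroup_of_isAnticyclotomic` (local Kronecker–Weber
   on `I_{ℚ_p}` + Brink 2007) with `inertia_adicCompletionPrime_eq_map_absInertia`: the inertia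
   `(ker κ)_v ∩ I_{K_v}` lies in `G₁`.  Hence every open `O ≥ G₁` carries a unit-trace element
   (`exists_smul_eq_of_algNorm_le_one_of_sum_smul_eq_one`), and the engine caller
   `KernelH1OfTrace.exists_eq_smul_sub_of_trace` (successive approximation, zero level
   `O₀ = Gal(K̄_v/L₀)·G₁` for a Krull neighbourhood field `L₀` of the zero set) kills `φ₁`.

THEOREMS ONLY (no definition, no named fact); `K : Type` (universe of
`H1_goodModelKernel_trivial_of_cyclotomicZpExtension deeplyRamified_cyclotomicZpExtension_trace_holds`).  Input of (D) `strict ⟹ Kummer` at `H = ker κ`, i.e. of the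
frame-restricted kernel discharge of the leaf `Greenberg1999.imKummer_eq_strictCondition_goodOrdinary_
numberField` (G-2.4) on the rows-9/10 frames (stmt-BirchSwinnertonDyer-23237).  BSD is not proved by
any of this.

References: [CoatesGreenberg1996] Invent. Math. 124 (1996) Thm. 2.13, Cor. 3.2, Prop. 4.3;
[GreenbergLNM1716] Greenberg §2 pp. 83–84, §1 p. 53; [Brink2007] Cor. 1; [SerreLocalFields1979]
Ch. V §1, Ch. XIV §7.
-/

-- the summit namespace `Summit.BirchSwinnertonDyer.BirchSwinnertonDyer` repeats the problem name by design (D-0017)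
set_option linter.dupNamespace false

noncomputable section

open scoped Classical NNReal Pointwise

open WeierstrassCurve NumberField IsDedekindDomain Field IsDedekindDomain.HeightOneSpectrum
  Literature.NumberTheory.GaloisRepresentations Literature.NumberTheory.EllipticCurves
  Literature.NumberTheory.EllipticCurves.CoatesGreenberg1996
  Literature.NumberTheory.GaloisRepresentations.IsNonarchimedeanLocalField
  Summit.BirchSwinnertonDyer.Rank1Residual.Additive.GoodModelLine

namespace Summit.BirchSwinnertonDyer.BirchSwinnertonDyer.Theorems.AnticyclotomicFormalGroupH1

variable {K : Type} [Field K] [NumberField K]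

/-! ## §1 Transport to the spectral model (copies of the private lemmas of `GoodModelKernelH1Trivial`) -/

/-- Composition of two transports along equalities of Weierstrass equations. [folklore] -/
private theorem congrEquiv_congrEquiv {F : Type} [Field F] {W₁ W₂ W₃ : WeierstrassCurve F}
    (h₁ : W₁ = W₂) (h₂ : W₂ = W₃) (P : W₁.toAffine.Point) :
    Affine.Point.congrEquiv h₂ (Affine.Point.congrEquiv h₁ P) =
      Affine.Point.congrEquiv (h₁.trans h₂) P := by
  subst h₁; subst h₂; rfl

variable (W : WeierstrassCurve K) (v : HeightOneSpectrum (𝓞 K))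

/-- The `K_v`-rational change to the minimal model carries `(E ⊗ K_v) ⊗ K̄_v` to the base change of
the spectral minimal model. [folklore] -/
private theorem minimalChange_smul_baseChange :
    (((W.baseChange (v.adicCompletion K)).exists_isMinimal (v.adicCompletionIntegers K)).choose.map
        (algebraMap (v.adicCompletion K) (AlgebraicClosure (v.adicCompletion K)))) •
      (W.baseChange (v.adicCompletion K)).baseChange (AlgebraicClosure (v.adicCompletion K)) =
      (W.localSpectralModel v).baseChange (AlgebraicClosure (v.adicCompletion K)) := by
  rw [← VariableChange.baseChange_smul_eq, W.smul_baseChange_eq_map_localMinimalIntegralModel v,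
    W.localSpectralModel_baseChange v]

/-- The transport `E(K̄_v) → M(K̄_v)` of `localKernelOfReduction` is the transport along the
minimal change. [folklore] -/
private theorem localPointsEquivSpectralModel_eq (P : localPoints W (v.adicCompletion K)) :
    W.localPointsEquivSpectralModel v P =
      Affine.Point.congrEquiv (minimalChange_smul_baseChange W v)
        (VariableChange.pointEquiv _
          (((W.baseChange (v.adicCompletion K)).exists_isMinimal (v.adicCompletionIntegers K)).choose.map
            (algebraMap (v.adicCompletion K) (AlgebraicClosure (v.adicCompletion K))))
          (Affine.Point.congrEquiv (baseChange_baseChange_adicCompletion W v).symm P)) := by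
  rw [localPointsEquivSpectralModel, AddEquiv.trans_apply, localPointsEquivModel_apply,
    localPointsEquivPoint_apply, VariableChange.pointEquivBaseChange, AddEquiv.trans_apply,
    congrEquiv_congrEquiv, congrEquiv_congrEquiv]

/-- Membership in `E₁(K̄_v)` is membership of the transport in `kernelOfReduction` of the spectral
model. [folklore] -/
private theorem mem_localKernelOfReduction_iff_transport (P : localPoints W (v.adicCompletion K)) :
    P ∈ W.localKernelOfReduction v ↔
      Affine.Point.congrEquiv (minimalChange_smul_baseChange W v) (VariableChange.pointEquiv _
        (((W.baseChange (v.adicCompletion K)).exists_isMinimal (v.adicCompletionIntegers K)).choose.map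
          (algebraMap (v.adicCompletion K) (AlgebraicClosure (v.adicCompletion K))))
        (Affine.Point.congrEquiv (baseChange_baseChange_adicCompletion W v).symm P)) ∈
        kernelOfReduction (W.localSpectralModel v) (Valuation.integer.integers v.spectralValuation) := by
  rw [localKernelOfReduction, AddSubgroup.mem_comap]
  change W.localPointsEquivSpectralModel v P ∈ _ ↔ _
  rw [localPointsEquivSpectralModel_eq W v P]

/-- The minimal change is `K_v`-rational: fixed by every `τ ∈ Γ_{K_v}`. [folklore] -/
private theorem minimalChange_map (τ : absoluteGaloisGroup (v.adicCompletion K)) :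
    (((W.baseChange (v.adicCompletion K)).exists_isMinimal (v.adicCompletionIntegers K)).choose.map
      (algebraMap (v.adicCompletion K) (AlgebraicClosure (v.adicCompletion K)))).map
      ((absoluteGaloisGroup.toAlgEquiv (v.adicCompletion K) τ :
        AlgebraicClosure (v.adicCompletion K) ≃ₐ[v.adicCompletion K]
          AlgebraicClosure (v.adicCompletion K)) :
        AlgebraicClosure (v.adicCompletion K) →+* AlgebraicClosure (v.adicCompletion K)) =
    ((W.baseChange (v.adicCompletion K)).exists_isMinimal (v.adicCompletionIntegers K)).choose.map
      (algebraMap (v.adicCompletion K) (AlgebraicClosure (v.adicCompletion K))) := by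
  rw [VariableChange.map_map]
  congr 1
  ext x
  exact AlgEquiv.commutes _ x

/-! ## §2 The cyclotomic theorem for a closed subgroup of `(ker κ^{cyc})_v`, in `E₁(K̄_v)` currency -/

/-- **[CoGr] Cor. 3.2 (cyclotomic) for a CLOSED `G' ≤ (ker κ^{cyc})_v`**: every continuous crossed
homomorphism `G' → E(K̄_v)` with values in `E₁(K̄_v)` is the coboundary of a point of `E₁(K̄_v)`
(`H1_goodModelKernel_trivial_of_cyclotomicZpExtension deeplyRamified_cyclotomicZpExtension_trace_holds` at the spectral minimal model and the rational minimal change).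
[cite: CoatesGreenberg1996, Cor. 3.2 (through GreenbergLNM1716 p. 83)] -/
theorem exists_mem_localKernelOfReduction_eq_smul_sub_of_le_cyclotomic [W.IsElliptic]
    {p : ℕ} [Fact p.Prime] {κc : ZpExtension K p} (hκc : κc.IsCyclotomic)
    (hpv : ((p : ℕ) : 𝓞 K) ∈ v.asIdeal) (hgood : W.HasGoodReductionAt v)
    (G' : Subgroup (absoluteGaloisGroup (v.adicCompletion K)))
    (hG'c : IsClosed (G' : Set (absoluteGaloisGroup (v.adicCompletion K))))
    (hG'le : G' ≤ localSubgroup κc.kerSubgroup (v.adicCompletion K))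
    (ψ : contOneCocycles (discreteTopRep G' (localPoints W (v.adicCompletion K))))
    (hψ : ∀ g, ψ.1 g ∈ W.localKernelOfReduction v) :
    ∃ a ∈ W.localKernelOfReduction v, ∀ g, ψ.1 g = g • a - a := by
  obtain ⟨a, ha, hφa⟩ := H1_goodModelKernel_trivial_of_cyclotomicZpExtension
    deeplyRamified_cyclotomicZpExtension_trace_holds K W p κc hκc v hpv v.spectralValuation
    (coe_spectralValuation v) _ (W.localSpectralModel v) (minimalChange_smul_baseChange W v)
    (W.isUnit_Δ_localSpectralModel hgood) G' hG'c hG'le (fun σ _ ↦ minimalChange_map W v σ) ψ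
    (fun g ↦ (mem_localKernelOfReduction_iff_transport W v _).1 (hψ g))
  exact ⟨a, (mem_localKernelOfReduction_iff_transport W v a).2 ha, hφa⟩

/-! ## §3 Norm bridge: `algNorm ≤ 1` gives `|·|_v ≤ 1` -/

/-- `‖x‖ ≤ 1` for the tree's absolute value `algNorm K_v` implies `|x|_v ≤ 1` for the spectral
valuation (both are positive powers of one another, `exists_norm_eq_spectralNorm_rpow`). [folklore] -/
private theorem spectralValuation_le_one_of_algNorm_le_one (x : AlgebraicClosure (v.adicCompletion K))
    (hx : algNorm (v.adicCompletion K) x ≤ 1) : v.spectralValuation x ≤ 1 := by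
  obtain ⟨c, hc, hnorm⟩ := exists_norm_eq_spectralNorm_rpow v
  have h := hnorm (Literature.NumberTheory.PAdicHodge.NormedAlgClosure.toAlgClosure.symm x)
  rw [Literature.NumberTheory.PAdicHodge.NormedAlgClosure.norm_def, AlgEquiv.apply_symm_apply] at h
  change algNorm (v.adicCompletion K) x =
    spectralNorm (v.adicCompletion K) (AlgebraicClosure (v.adicCompletion K)) x ^ c at h
  rw [← coe_spectralValuation v] at h
  by_contra hlt
  push Not at hlt
  have h1 : (1 : ℝ) < (v.spectralValuation x : ℝ) := by exact_mod_cast hlt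
  have h2 := Real.one_lt_rpow h1 hc
  rw [← h] at h2
  exact absurd hx (not_le.mpr h2)

/-! ## §4 Cocycle plumbing: restriction to a subgroup, subtracting a coboundary -/

/-- Restriction of a continuous crossed homomorphism to a smaller subgroup of `Γ_{K_v}`. [folklore] -/
private theorem exists_restrict {G G₁ : Subgroup (absoluteGaloisGroup (v.adicCompletion K))} (hle : G₁ ≤ G)
    (φ : contOneCocycles (discreteTopRep G (localPoints W (v.adicCompletion K)))) :
    ∃ ψ : contOneCocycles (discreteTopRep G₁ (localPoints W (v.adicCompletion K))),
      ∀ g : G₁, ψ.1 g = φ.1 (Subgroup.inclusion hle g) := by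
  let θ : G₁ →ₜ* G :=
    { toMonoidHom := Subgroup.inclusion hle
      continuous_toFun := continuous_subtype_val.subtype_mk _ }
  have hθ : ∀ g, θ g = Subgroup.inclusion hle g := fun _ ↦ rfl
  refine ⟨contOneCocycles.pullback θ
    (resHomOfEquivariant θ (AddMonoidHom.id (localPoints W (v.adicCompletion K))) (fun _ _ ↦ rfl)) φ,
    fun g ↦ ?_⟩
  rw [contOneCocycles.pullback_apply, hθ]
  rfl

/-- Subtracting the coboundary of a point from a continuous crossed homomorphism. [folklore] -/
private theorem exists_sub_coboundary {G : Subgroup (absoluteGaloisGroup (v.adicCompletion K))}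
    (φ : contOneCocycles (discreteTopRep G (localPoints W (v.adicCompletion K))))
    (a : localPoints W (v.adicCompletion K)) :
    ∃ φ₁ : contOneCocycles (discreteTopRep G (localPoints W (v.adicCompletion K))),
      ∀ g : G, φ₁.1 g = φ.1 g - ((g : absoluteGaloisGroup (v.adicCompletion K)) • a - a) := by
  have hcont : Continuous fun g : G ↦ g • a := by
    have hc : Continuous ((fun σ : absoluteGaloisGroup (v.adicCompletion K) ↦ σ • a) ∘
        (Subtype.val : G → absoluteGaloisGroup (v.adicCompletion K))) :=
      (continuous_smul_localPoints W (v.adicCompletion K) a).comp continuous_subtype_val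
    exact hc
  exact ⟨φ - coboundaryCocycle a hcont, fun g ↦ by rw [cocycle_sub_apply, coboundaryCocycle_apply]; rfl⟩

/-! ## §5 The anticyclotomic vanishing -/

/-- **`H¹(K_{∞,w}⁻, E₁(K̄_v)) = 0` in cocycle form.**  For `K` imaginary quadratic, `p` odd and
split in `K` (`v ≠ v̄` above `p`), `κ` anticyclotomic, `E = W/K` elliptic with good reduction at
`v`: every continuous crossed homomorphism of `(ker κ)_v = Gal(K̄_v/K_{∞,w}⁻)` into `E(K̄_v)` with
values in `E₁(K̄_v)` is `g ↦ g • a - a` with `a ∈ E₁(K̄_v)` — [CoGr] Prop. 4.3 / Cor. 3.2 for the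
deeply ramified field `K_{∞,w}⁻` (Greenberg LNM 1716 p. 84), here from the CYCLOTOMIC theorem by
unramified descent along `K̃_∞/K_∞⁻` (module docstring, steps 1–2).
[cite: CoatesGreenberg1996, Cor. 3.2 and Prop. 4.3 (through GreenbergLNM1716 pp. 83–84)]
[cite: GreenbergLNM1716, §1 p. 53 and §2 p. 84] [cite: Brink2007, Cor. 1 (p. 2136)] -/
theorem exists_mem_localKernelOfReduction_eq_smul_sub_of_isAnticyclotomic [W.IsElliptic]
    (hK : IsImaginaryQuadratic K) {p : ℕ} [Fact p.Prime] (hp2 : p ≠ 2)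
    (κ : ZpExtension K p) (hκ : κ.IsAnticyclotomic)
    {vbar : HeightOneSpectrum (𝓞 K)} (hpv : ((p : ℕ) : 𝓞 K) ∈ v.asIdeal)
    (hpvbar : ((p : ℕ) : 𝓞 K) ∈ vbar.asIdeal) (hne : vbar ≠ v) (hgood : W.HasGoodReductionAt v)
    (φ : contOneCocycles (discreteTopRep (localSubgroup κ.kerSubgroup (v.adicCompletion K))
      (localPoints W (v.adicCompletion K))))
    (hφ : ∀ g, φ.1 g ∈ W.localKernelOfReduction v) :
    ∃ a ∈ W.localKernelOfReduction v, ∀ g, φ.1 g = g • a - a := by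
  -- structure
  haveI : CharZero (v.adicCompletion K) :=
    charZero_of_injective_algebraMap (algebraMap K (v.adicCompletion K)).injective
  haveI : CompactSpace (absoluteGaloisGroup (v.adicCompletion K)) := absoluteGaloisGroup_compactSpace (v.adicCompletion K)
  have hGc : IsClosed ((localSubgroup κ.kerSubgroup (v.adicCompletion K)) : Set (absoluteGaloisGroup (v.adicCompletion K))) := by
    rw [localSubgroup_eq_comap, Subgroup.coe_comap]
    exact κ.isClosed_kerSubgroup.preimage (map_continuous (resGal (K := K) (v.adicCompletion K)))
  haveI hGn : (localSubgroup κ.kerSubgroup (v.adicCompletion K)).Normal := by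
    rw [localSubgroup_eq_comap]
    haveI : κ.kerSubgroup.Normal := MonoidHom.normal_ker _
    exact Subgroup.Normal.comap inferInstance _
  -- the cyclotomic `ℤ_p`-extension and `G₁ = (ker κ)_v ∩ (ker κ^cyc)_v`
  obtain ⟨κc, hκc⟩ := ZpExtension.exists_isCyclotomic_holds K p
    (GaloisRep.cyclotomicCharacter_range_infinite K p)
  have hGcc : IsClosed ((localSubgroup κc.kerSubgroup (v.adicCompletion K)) : Set (absoluteGaloisGroup (v.adicCompletion K))) := by
    rw [localSubgroup_eq_comap, Subgroup.coe_comap]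
    exact κc.isClosed_kerSubgroup.preimage (map_continuous (resGal (K := K) (v.adicCompletion K)))
  haveI hGcn : (localSubgroup κc.kerSubgroup (v.adicCompletion K)).Normal := by
    rw [localSubgroup_eq_comap]
    haveI : κc.kerSubgroup.Normal := MonoidHom.normal_ker _
    exact Subgroup.Normal.comap inferInstance _
  obtain ⟨G₁, hG₁def⟩ : ∃ G₁ : Subgroup (absoluteGaloisGroup (v.adicCompletion K)),
      G₁ = (localSubgroup κ.kerSubgroup (v.adicCompletion K)) ⊓ localSubgroup κc.kerSubgroup (v.adicCompletion K) := ⟨_, rfl⟩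
  have hG₁c : IsClosed (G₁ : Set (absoluteGaloisGroup (v.adicCompletion K))) := by rw [hG₁def]; exact hGc.inter hGcc
  have hG₁G : G₁ ≤ (localSubgroup κ.kerSubgroup (v.adicCompletion K)) := by rw [hG₁def]; exact inf_le_left
  have hG₁Gc : G₁ ≤ localSubgroup κc.kerSubgroup (v.adicCompletion K) := by rw [hG₁def]; exact inf_le_right
  haveI hG₁n : G₁.Normal := by rw [hG₁def]; infer_instance
  -- §A step 1: kill the restriction of `φ` to `G₁` by the cyclotomic theorem
  obtain ⟨ψ, hψapply⟩ := exists_restrict W v hG₁G φ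
  have hψval : ∀ g : G₁, ψ.1 g ∈ W.localKernelOfReduction v := fun g ↦ by
    rw [hψapply]; exact hφ (Subgroup.inclusion hG₁G g)
  obtain ⟨a, ha, hψa⟩ := exists_mem_localKernelOfReduction_eq_smul_sub_of_le_cyclotomic W v hκc
    hpv hgood G₁ hG₁c hG₁Gc ψ hψval
  -- `φ₁ = φ - ∂a`
  obtain ⟨φ₁, hφ₁apply⟩ := exists_sub_coboundary W v φ a
  have hφ₁val : ∀ g : (localSubgroup κ.kerSubgroup (v.adicCompletion K)), φ₁.1 g ∈ W.localKernelOfReduction v := by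
    intro g
    rw [hφ₁apply]
    exact sub_mem (hφ g) (sub_mem ((W.smul_mem_localKernelOfReduction_iff v _ a).2 ha) ha)
  -- `φ₁` vanishes on `G₁`
  have hφ₁G₁ : ∀ g : (localSubgroup κ.kerSubgroup (v.adicCompletion K)), (g : (absoluteGaloisGroup (v.adicCompletion K))) ∈ G₁ → φ₁.1 g = 0 := by
    intro g hg
    have h := hψa ⟨g, hg⟩
    rw [hψapply] at h
    have hincl : Subgroup.inclusion hG₁G ⟨(g : (absoluteGaloisGroup (v.adicCompletion K))), hg⟩ = g := Subtype.ext rfl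
    rw [hincl] at h
    rw [hφ₁apply, h, sub_eq_zero]
    rfl
  -- the values of `φ₁` are `G₁`-fixed (`G₁ ⊴ Γ_(K_v)`, cocycle identity)
  have hG₁φ₁ : ∀ g ∈ G₁, ∀ h : (localSubgroup κ.kerSubgroup (v.adicCompletion K)), g • φ₁.1 h = φ₁.1 h := by
    intro g hg h
    obtain ⟨g', hg'⟩ : ∃ g' : (localSubgroup κ.kerSubgroup (v.adicCompletion K)), (g' : (absoluteGaloisGroup (v.adicCompletion K))) = g := ⟨⟨g, hG₁G hg⟩, rfl⟩
    subst hg'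
    have hk : ((h⁻¹ * g' * h : (localSubgroup κ.kerSubgroup (v.adicCompletion K))) : (absoluteGaloisGroup (v.adicCompletion K))) ∈ G₁ := by
      rw [Subgroup.coe_mul, Subgroup.coe_mul, Subgroup.coe_inv]
      exact hG₁n.conj_mem' _ hg _
    have h1 : φ₁.1 (g' * h) = (g' : (absoluteGaloisGroup (v.adicCompletion K))) • φ₁.1 h := by
      rw [φ₁.2 g' h, hφ₁G₁ g' hg, zero_add]; rfl
    have h2 : φ₁.1 (g' * h) = φ₁.1 h := by
      have : g' * h = h * (h⁻¹ * g' * h) := by group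
      rw [this, φ₁.2 h (h⁻¹ * g' * h), hφ₁G₁ _ hk, map_zero, add_zero]
    exact h1.symm.trans h2
  -- §B step 2: the zero level `O₀ = Gal(K̄_v/L₀) ⊔ G₁`, `L₀` a Krull neighbourhood of the zero set
  obtain ⟨L₀, hL₀fin, hL₀normal, hL₀sub⟩ := KernelH1.exists_normal_fixingSubgroup_subset (localSubgroup κ.kerSubgroup (v.adicCompletion K))
    ((isOpen_discrete ({0} : Set (localPoints W (v.adicCompletion K)))).preimage φ₁.1.continuous)
    (show (1 : (localSubgroup κ.kerSubgroup (v.adicCompletion K))) ∈ φ₁.1 ⁻¹' {0} from contOneCocycles.apply_one φ₁)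
  haveI := hL₀fin
  haveI := hL₀normal
  obtain ⟨X, hXdef⟩ : ∃ X : Subgroup (absoluteGaloisGroup (v.adicCompletion K)),
      X = L₀.fixingSubgroup.comap (absoluteGaloisGroup.toAlgEquiv (v.adicCompletion K)).toMonoidHom := ⟨_, rfl⟩
  have hX_mem : ∀ τ, τ ∈ X ↔ absoluteGaloisGroup.toAlgEquiv (v.adicCompletion K) τ ∈ L₀.fixingSubgroup :=
    fun _ ↦ by rw [hXdef]; exact Subgroup.mem_comap
  have hXopen : IsOpen (X : Set (absoluteGaloisGroup (v.adicCompletion K))) := by rw [hXdef]; exact L₀.fixingSubgroup_isOpen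
  haveI hXn : X.Normal := by rw [hXdef]; exact KernelH1.fixingSubgroup_comap_normal L₀
  have hO₀open : IsOpen ((X ⊔ G₁ : Subgroup (absoluteGaloisGroup (v.adicCompletion K))) : Set (absoluteGaloisGroup (v.adicCompletion K))) :=
    Subgroup.isOpen_mono (le_sup_left : X ≤ X ⊔ G₁) hXopen
  have hG₁O₀ : G₁ ≤ X ⊔ G₁ := le_sup_right
  have hφO₀ : ∀ u : (localSubgroup κ.kerSubgroup (v.adicCompletion K)), (u : (absoluteGaloisGroup (v.adicCompletion K))) ∈ X ⊔ G₁ → φ₁.1 u = 0 := by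
    intro u hu
    have hu' : (u : (absoluteGaloisGroup (v.adicCompletion K))) ∈ ((X : Set (absoluteGaloisGroup (v.adicCompletion K))) * (G₁ : Set (absoluteGaloisGroup (v.adicCompletion K)))) := by
      rw [← Subgroup.normal_mul]; exact hu
    obtain ⟨x, hx, g₁, hg₁, hxg⟩ := Set.mem_mul.mp hu'
    have hxG : x ∈ (localSubgroup κ.kerSubgroup (v.adicCompletion K)) := by
      have : x = (u : (absoluteGaloisGroup (v.adicCompletion K))) * g₁⁻¹ := by rw [← hxg, mul_inv_cancel_right]
      rw [this]
      exact Subgroup.mul_mem _ u.2 (Subgroup.inv_mem _ (hG₁G hg₁))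
    have hx0 : φ₁.1 ⟨x, hxG⟩ = 0 := hL₀sub ⟨x, hxG⟩ ((hX_mem x).mp hx)
    have hueq : u = (⟨x, hxG⟩ : (localSubgroup κ.kerSubgroup (v.adicCompletion K))) * ⟨g₁, hG₁G hg₁⟩ := Subtype.ext hxg.symm
    rw [hueq, φ₁.2, hx0, hφ₁G₁ _ hg₁, map_zero, add_zero]
  -- §C the inertia of `(ker κ)_v` lies in `G₁` (`K̃_∞/K_∞⁻` unramified above the split `p`)
  have hGI : (localSubgroup κ.kerSubgroup (v.adicCompletion K)) ⊓ absInertia (v.adicCompletion K) ≤ G₁ := by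
    intro σ hσ
    obtain ⟨hσG, hσI⟩ := Subgroup.mem_inf.mp hσ
    rw [hG₁def]
    refine Subgroup.mem_inf.mpr ⟨hσG, ?_⟩
    rw [mem_localSubgroup_iff]
    have hres : resGal (K := K) (v.adicCompletion K) σ ∈
        (adicCompletionPrime K v).inertia (absoluteGaloisGroup K) := by
      rw [inertia_adicCompletionPrime_eq_map_absInertia]
      exact Subgroup.mem_map_of_mem _ hσI
    have hσκ : resGal (K := K) (v.adicCompletion K) σ ∈ κ.kerSubgroup := (mem_localSubgroup_iff _ _ σ).mp hσG
    exact ZpExtension.inertia_inf_kerSubgroup_le_kerSubgroup_of_isAnticyclotomic hK hp2 hκ κc hpv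
      hpvbar hne hpv (adicCompletionPrime_mem_primesAbove K v) ⟨hres, hσκ⟩
  -- §D the trace elements above `G₁` (unramified finite quotients)
  have htr : ∀ O : Subgroup (absoluteGaloisGroup (v.adicCompletion K)), IsOpen (O : Set (absoluteGaloisGroup (v.adicCompletion K))) → G₁ ≤ O →
      ∀ [Fintype ((localSubgroup κ.kerSubgroup (v.adicCompletion K)) ⧸ O.subgroupOf (localSubgroup κ.kerSubgroup (v.adicCompletion K)))],
        ∃ x : AlgebraicClosure (v.adicCompletion K), v.spectralValuation x ≤ 1 ∧
          (∀ u ∈ O ⊓ (localSubgroup κ.kerSubgroup (v.adicCompletion K)), u • x = x) ∧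
          v.spectralValuation (∑ q : (localSubgroup κ.kerSubgroup (v.adicCompletion K)) ⧸ O.subgroupOf (localSubgroup κ.kerSubgroup (v.adicCompletion K)),
            ((q.out : (localSubgroup κ.kerSubgroup (v.adicCompletion K))) : (absoluteGaloisGroup (v.adicCompletion K))) • x) = 1 := by
    intro O hO hG₁O _
    obtain ⟨x, hx1, hxU, hxsum⟩ := exists_smul_eq_of_algNorm_le_one_of_sum_smul_eq_one (localSubgroup κ.kerSubgroup (v.adicCompletion K))
      hGc.isCompact O hO (hGI.trans hG₁O)
    exact ⟨x, spectralValuation_le_one_of_algNorm_le_one v x hx1, hxU, by rw [hxsum, map_one]⟩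
  -- §E the engine caller
  obtain ⟨b, hb, hφ₁b⟩ := KernelH1OfTrace.exists_eq_smul_sub_of_trace W v.spectralValuation
    (coe_spectralValuation v) _ (W.localSpectralModel v) (minimalChange_smul_baseChange W v)
    (W.isUnit_Δ_localSpectralModel hgood) (minimalChange_map W v) (localSubgroup κ.kerSubgroup (v.adicCompletion K)) hGc G₁ htr (X ⊔ G₁) hO₀open
    hG₁O₀ φ₁ hφO₀ hG₁φ₁ (fun g ↦ (mem_localKernelOfReduction_iff_transport W v _).1 (hφ₁val g))
  refine ⟨b + a, add_mem ((mem_localKernelOfReduction_iff_transport W v b).2 hb) ha, fun g ↦ ?_⟩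
  have h := hφ₁b g
  rw [hφ₁apply, sub_eq_iff_eq_add] at h
  rw [h]
  simp only [Subgroup.smul_def, smul_add]
  abel

end Summit.BirchSwinnertonDyer.BirchSwinnertonDyer.Theorems.AnticyclotomicFormalGroupH1

end
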